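import Literature.Analysis.Complex.Mergelyan
import HarnessLib

/-!
# Lavrentiev's theorem (the case `K° = ∅` of Mergelyan): annihilated moments

If `K ⊆ ℂ` is compact with EMPTY INTERIOR and connected complement, Mergelyan's theorem
(`Literature.Analysis.Complex.mergelyan`, Rudin Thm 20.5, proved in the tree) carries no
holomorphy hypothesis at all: every continuous function on `K` is a uniform limit of polynomials,
`P(K) = C(K)` (M. A. Lavrentiev 1934; Gaier, Ch. III §2.A, special cases of Thm 1). We record the
consequence used for moment problems on thin sets: a functional dominated by the sup norm on `K`
that kills the monomials `zⁿ`, `n ≥ n₀`, kills every continuous function vanishing near `0`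
(approximate `f / z^{n₀}` by polynomials `P`; then `z^{n₀} P` is a combination of killed monomials
uniformly close to `f` on `K`).

* `functional_eq_zero_of_forall_moment_eq_zero` — for a functional `Λ` on `ℂ → ℂ` which is
  additive and homogeneous on continuous functions with `‖Λ F‖ ≤ T · sup_K ‖F‖`;
* `integral_eq_zero_of_forall_moment_eq_zero` — the case `Λ F = ∫ F S dμ` of a finite measure `μ`
  carried by `K` with a bounded measurable density `S`.

The functional form is what series of measures on the spokes of a hedgehog consume
(`Literature/Analysis/Complex/HedgehogMoments.lean`) without first assembling one measure on `ℂ`.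
Not here: the approximation statement `P(K) = C(K)` itself (it is `mergelyan` with a vacuous
differentiability hypothesis) and the necessity of `K° = ∅`, `ℂ ∖ K` connected.
[cite: Rudin1987, Thm 20.5] [cite: Gaier1987, Ch. III §2.A Thm 1]
-/

noncomputable section

namespace Literature.Analysis.Complex

open _root_.MeasureTheory Set Filter Metric _root_.Complex
open scoped Real _root_.Topology Polynomial

/-- **Lavrentiev via Mergelyan, functional form.** Let `K ⊆ ℂ` be compact with empty interior and
connected complement, and let `Λ` be a functional on `ℂ → ℂ` which is additive and homogeneous on
continuous functions and dominated by the sup norm on `K` (`‖Λ F‖ ≤ T · sup_K ‖F‖`). If `Λ`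
annihilates the monomials `zⁿ`, `n ≥ n₀`, then `Λ f = 0` for every continuous `f` vanishing on a
neighbourhood of `0`: approximate `f / z^{n₀}` uniformly on `K` by polynomials (Mergelyan's theorem
with `K° = ∅`, i.e. Lavrentiev's `P(K) = C(K)`). [cite: Gaier1987, Ch. III §2.A Thm 1] -/
theorem functional_eq_zero_of_forall_moment_eq_zero {K : Set ℂ} (hK : IsCompact K)
    (hKi : interior K = ∅) (hKc : IsPreconnected Kᶜ) {Λ : (ℂ → ℂ) → ℂ} {T : ℝ}
    (hadd : ∀ F G : ℂ → ℂ, Continuous F → Continuous G → Λ (F + G) = Λ F + Λ G)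
    (hmul : ∀ (a : ℂ) (F : ℂ → ℂ), Continuous F → Λ (fun z => a * F z) = a * Λ F)
    (hbd : ∀ (F : ℂ → ℂ) (ε : ℝ), Continuous F → (∀ z ∈ K, ‖F z‖ ≤ ε) → ‖Λ F‖ ≤ T * ε)
    {n₀ : ℕ} (hmom : ∀ n : ℕ, n₀ ≤ n → Λ (fun z => z ^ n) = 0)
    {f : ℂ → ℂ} (hf : Continuous f) {r : ℝ} (hr : 0 < r) (hf0 : ∀ z, ‖z‖ < r → f z = 0) :
    Λ f = 0 := by
  -- `g = f / z^{n₀}` is continuous and `f = z^{n₀} g`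
  set g : ℂ → ℂ := fun z => f z / z ^ n₀ with hg
  have hgc : Continuous g := by
    refine continuous_iff_continuousAt.2 fun z => ?_
    by_cases hz : z = 0
    · subst hz
      refine Filter.EventuallyEq.continuousAt (y := 0) ?_
      filter_upwards [Metric.ball_mem_nhds (0 : ℂ) hr] with w hw
      simp only [hg, hf0 w (mem_ball_zero_iff.1 hw), zero_div]
    · exact hf.continuousAt.div (continuous_pow n₀).continuousAt (pow_ne_zero _ hz)
  have hfg : ∀ z, f z = z ^ n₀ * g z := by
    intro z
    by_cases hz : z ^ n₀ = 0
    · rw [hz, zero_mul]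
      exact hf0 z (by rw [(pow_eq_zero_iff'.1 hz).1, norm_zero]; exact hr)
    · simp only [hg, mul_div_cancel₀ _ hz]
  -- `T ≥ 0`, a radius bound, `Λ 0 = 0`
  have hT : 0 ≤ T := by
    have := hbd (fun _ => 0) 1 continuous_const (fun z _ => by simp)
    rw [mul_one] at this
    exact (norm_nonneg _).trans this
  obtain ⟨R, hR0, hR⟩ := hK.isBounded.exists_pos_norm_le
  have hΛ0 : Λ (fun _ => 0) = 0 := by
    simpa using hmul 0 (fun _ => (0 : ℂ)) continuous_const
  -- `Λ` vanishes on `z^{n₀} P` for every polynomial `P`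
  have hpoly : ∀ P : ℂ[X], Λ (fun z => z ^ n₀ * P.eval z) = 0 := by
    intro P
    have key : ∀ s : Finset ℕ, Λ (fun z => ∑ i ∈ s, P.coeff i * z ^ (n₀ + i)) = 0 := by
      intro s
      induction s using Finset.induction_on with
      | empty => simpa using hΛ0
      | insert a s ha ih =>
        have hsplit : (fun z : ℂ => ∑ i ∈ insert a s, P.coeff i * z ^ (n₀ + i)) =
            (fun z : ℂ => P.coeff a * z ^ (n₀ + a)) +
              fun z => ∑ i ∈ s, P.coeff i * z ^ (n₀ + i) := by
          funext z
          rw [Pi.add_apply, Finset.sum_insert ha]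
        rw [hsplit, hadd _ _ (by fun_prop) (continuous_finsetSum s fun i _ => by fun_prop), ih,
          add_zero, hmul _ _ (continuous_pow _), hmom _ (Nat.le_add_right _ _), mul_zero]
    have : (fun z : ℂ => z ^ n₀ * P.eval z) =
        fun z => ∑ i ∈ Finset.range (P.natDegree + 1), P.coeff i * z ^ (n₀ + i) := by
      funext z
      rw [Polynomial.eval_eq_sum_range, Finset.mul_sum]
      exact Finset.sum_congr rfl fun i _ => by ring
    rw [this]
    exact key _
  -- the `ε`-argument
  refine norm_le_zero_iff.1 (le_of_forall_pos_le_add fun ε hε => ?_)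
  rw [zero_add]
  set M : ℝ := T * R ^ n₀ + 1 with hM
  have hM0 : 0 < M := by positivity
  obtain ⟨P, hP⟩ := mergelyan hK hKc hgc.continuousOn
    (by rw [hKi]; exact differentiableOn_empty) (div_pos hε hM0)
  have hcQ : Continuous fun z : ℂ => z ^ n₀ * P.eval z := (continuous_pow n₀).mul P.continuous
  have hsplit : f = (fun z => f z - z ^ n₀ * P.eval z) + fun z => z ^ n₀ * P.eval z := by
    funext z; simp
  rw [hsplit, hadd (fun z => f z - z ^ n₀ * P.eval z) _ (hf.sub hcQ) hcQ, hpoly P, add_zero]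
  refine (hbd (fun z => f z - z ^ n₀ * P.eval z) (R ^ n₀ * (ε / M)) (hf.sub hcQ)
    fun z hz => ?_).trans ?_
  · rw [hfg z, ← mul_sub, norm_mul, norm_pow]
    exact mul_le_mul (pow_le_pow_left₀ (norm_nonneg _) (hR z hz) _) (hP z hz).le
      (norm_nonneg _) (by positivity)
  · rw [← mul_assoc]
    calc T * R ^ n₀ * (ε / M) ≤ M * (ε / M) := by gcongr; linarith
      _ = ε := mul_div_cancel₀ _ hM0.ne'

/-- **Lavrentiev via Mergelyan.** Let `K ⊆ ℂ` be compact with empty interior and connected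
complement, `μ` a finite measure carried by `K`, `S` measurable with `‖S‖ ≤ M` `μ`-a.e. If
`∫ zⁿ S(z) dμ(z) = 0` for all `n ≥ n₀`, then `∫ f(z) S(z) dμ(z) = 0` for every continuous
`f : ℂ → ℂ` vanishing on a neighbourhood of `0` (approximate `f / z^{n₀}` on `K` by polynomials).
[cite: Gaier1987, Ch. III §2.A Thm 1] -/
theorem integral_eq_zero_of_forall_moment_eq_zero {K : Set ℂ} (hK : IsCompact K)
    (hKi : interior K = ∅) (hKc : IsPreconnected Kᶜ) {μ : Measure ℂ} [IsFiniteMeasure μ]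
    (hμ : μ Kᶜ = 0) {S : ℂ → ℂ} (hS : Measurable S) {M : ℝ} (hSM : ∀ᵐ z ∂μ, ‖S z‖ ≤ M) {n₀ : ℕ}
    (hmom : ∀ n : ℕ, n₀ ≤ n → ∫ z, z ^ n * S z ∂μ = 0)
    {f : ℂ → ℂ} (hf : Continuous f) {r : ℝ} (hr : 0 < r) (hf0 : ∀ z, ‖z‖ < r → f z = 0) :
    ∫ z, f z * S z ∂μ = 0 := by
  have hKae : ∀ᵐ z ∂μ, z ∈ K :=
    (measure_eq_zero_iff_ae_notMem.1 hμ).mono fun z hz => by simpa using hz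
  have hbound : ∀ (F : ℂ → ℂ) (C : ℝ), (∀ z ∈ K, ‖F z‖ ≤ C) →
      ∀ᵐ z ∂μ, ‖F z * S z‖ ≤ C * M := by
    intro F C hC
    filter_upwards [hKae, hSM] with z hz hzM
    rw [norm_mul]
    exact mul_le_mul (hC z hz) hzM (norm_nonneg _) ((norm_nonneg _).trans (hC z hz))
  have hint : ∀ F : ℂ → ℂ, Continuous F → Integrable (fun z => F z * S z) μ := by
    intro F hF
    obtain ⟨C, hC⟩ := hK.exists_bound_of_continuousOn hF.continuousOn
    exact Integrable.of_bound (hF.measurable.mul hS).aestronglyMeasurable (C * M) (hbound F C hC)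
  refine functional_eq_zero_of_forall_moment_eq_zero hK hKi hKc (Λ := fun F => ∫ z, F z * S z ∂μ)
    (T := M * μ.real univ) ?_ ?_ ?_ hmom hf hr hf0
  · intro F G hF hG
    simp only [Pi.add_apply, add_mul]
    exact integral_add (hint F hF) (hint G hG)
  · intro a F hF
    simp only [mul_assoc]
    exact integral_const_mul a _
  · intro F ε hF hFε
    calc ‖∫ z, F z * S z ∂μ‖ ≤ ε * M * μ.real univ :=
          norm_integral_le_of_norm_le_const (hbound F ε hFε)
      _ = M * μ.real univ * ε := by ring

end Literature.Analysis.Complex
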